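import Summits.QuantumFields.GaugeBoot.AdInvariantSchwingerDysonRowsUnitary
import Summits.QuantumFields.GaugeBoot.DiagonalRPTorusPlaquetteSign
import HarnessLib

/-!
# The conjugation-invariant sub-system of the polynomial Schwinger–Dyson rows does not determine the state (gauge-boot, L1 supplement)

HONEST FRAMING (cell `pub-gaugeboot`, page 1 of every file): the venture produces certified bounds
on lattice expectations at stated coupling, gauge group, dimension and torus size; NOT a mass gap,
NOT a continuum limit, NOT a string tension; NOT Yang–Mills-summit-bearing (barriers
`FixedCouplingUltralocality`, `PerturbativeInvisibility`). Structural (a no-information statement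
about a class of bootstrap rows); it certifies no number.

## Content

`PolynomialSchwingerDyson.lean` proved that the one-link Schwinger–Dyson rows over ALL polynomial
test functions (`IsPolySchwingerDysonState`) have exactly one probability solution in finite volume
— Wilson's measure. This file packages the complementary NEGATIVE statement of
`AdInvariantSchwingerDysonRows(Unitary).lean` as a predicate and a two-solutions theorem:

* `IsConjInvariantRowState r k S β μ` — `μ` satisfies the rows `∫ X·f dμ = β ∫ f · (X·S_i) dμ` for
  the test functions `f` that are polynomial AND invariant under global conjugation
  `U ↦ (g U_i g⁻¹)_i` (every link `i`, every generator of the family `k`);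
  `IsPolySchwingerDysonState.isConjInvariantRowState` — it is a SUB-SYSTEM of the polynomial rows;
* ★★ `isConjInvariantRowState_of_conjInvariant` — for traceless generators and conjugation-invariant
  polynomial local actions, EVERY conjugation-invariant finite measure satisfies it (Schur
  averaging: both sides of every such row vanish);
* `SU(N)` on the torus `(ℤ/L)^d` (Wilson action, shifts `e^{tX}`, `X ∈ 𝔰𝔲(N)`):
  ★★ `isConjInvariantRowState_suN_of_conjInvariant`, `isConjInvariantRowState_wilsonMeasure_suN`
  (Wilson's measure at ANY `β'` solves the sub-system at `β`), `isConjInvariantRowState_haar_suN`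
  (so does product Haar measure, at every `β`);
* ★★★ `haar_not_isPolySchwingerDysonState_suN` — whereas product Haar measure does NOT solve the
  full polynomial system at any `β > 0` (`N ≥ 2`, `L ≥ 2`, `d ≥ 2`): its plaquette mean is `0`
  (tree `integral_re_trace_plaquetteHolonomy_eq_zero`) while Wilson's is `> 0` (tree
  `wilsonExpectation_re_trace_plaquette_pos`);
* ★★★ `conjInvariantRows_two_solutions_suN` — THE NO-INFORMATION THEOREM: at every `β > 0` the
  conjugation-invariant sub-system has two probability solutions with DIFFERENT plaquette
  expectations (`0` and `> 0`). The conjugation-invariant (a fortiori gauge-invariant) rows of a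
  lattice bootstrap therefore cannot bound the plaquette by themselves; the cell's SDP draws its
  information from the covariant matrix-valued rows (`sd_pair`) and from positivity.

References: Yu. Makeenko, A. Migdal, Phys. Lett. B 88 (1979) 135; I. Montvay, G. Münster, *Quantum
fields on a lattice* (1994) §3.2–3.4; V. Kazakov, Z. Zheng, arXiv:2203.11360 §2; P. Anderson,
M. Kruczenski, Nucl. Phys. B 921 (2017) 702. Folklore; not located in print as stated.
-/

noncomputable section

open MeasureTheory Filter Topology NormedSpace
open scoped Matrix
open Literature.MathematicalPhysics.QuantumFieldTheory hiding ZdEdge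
open Literature.MathematicalPhysics.QuantumLattice

namespace Summit.QuantumFields.GaugeBoot

/-! ## The conjugation-invariant sub-system -/

section Generic

variable {ι : Type*} [DecidableEq ι] {G : Type*} [Group G] [TopologicalSpace G] [MeasurableSpace G]
  (r : LatticeRep G) {K : Type*}

/-- **Conjugation-invariant row state.** `μ` satisfies the one-link Schwinger–Dyson rows
`∫ X·f dμ = β ∫ f · (X·S_i) dμ` of the local actions `S i` along the family `k` for every test
function `f` that is a POLYNOMIAL observable INVARIANT UNDER GLOBAL CONJUGATION (`f'`, `S'` range
over the derivatives along the shift; they are unique). The sub-system of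
`IsPolySchwingerDysonState` seen by conjugation-invariant (e.g. gauge-invariant) test functions.
[shape] A parametric definition of a proposition — NOT a fact. [folklore] -/
def IsConjInvariantRowState (k : K → ℝ → G) (S : ι → (ι → G) → ℝ) (β : ℝ) (μ : Measure (ι → G)) :
    Prop :=
  ∀ (i : ι) (a : K), ∀ f ∈ polyFunctions (ι := ι) r, (∀ g U, f (conjAct g U) = f U) →
    ∀ f' S' : (ι → G) → ℝ,
      (∀ U, HasDerivAt (fun t => f (Function.update U i (k a t * U i))) (f' U) 0) →
      (∀ U, HasDerivAt (fun t => S i (Function.update U i (k a t * U i))) (S' U) 0) →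
      ∫ U, f' U ∂μ = β * ∫ U, f U * S' U ∂μ

variable {r}

/-- **It is a sub-system of the polynomial Schwinger–Dyson rows**: every polynomial Schwinger–Dyson
state is a conjugation-invariant row state (the family consists of exponential shifts
`ρ(k_a t) = e^{tX_a}`, so that polynomial observables have continuous derivatives). [folklore] -/
theorem IsPolySchwingerDysonState.isConjInvariantRowState [ContinuousMul G] {k : K → ℝ → G}
    (hX : ∀ a, ∃ X : Matrix (Fin r.N) (Fin r.N) ℂ, ∀ t, r.ρ (k a t) = exp ((t : ℂ) • X))
    {S : ι → (ι → G) → ℝ} {β : ℝ} {μ : Measure (ι → G)}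
    (hμ : IsPolySchwingerDysonState r k S β μ) : IsConjInvariantRowState r k S β μ := by
  intro i a f hf _ f' S' hf' hS'
  obtain ⟨S₀, -, hS₀, hrows⟩ := hμ i a
  obtain ⟨X, hXa⟩ := hX a
  obtain ⟨D, hD⟩ := exists_hasLinearShiftDeriv_of_mem_polyFunctions r i hf
  have hf'eq : f' = fun U => D U X := funext fun U => hD.eq_of_hasDerivAt hXa (hf' U)
  have hS'eq : S' = S₀ := funext fun U => (hS' U).unique (hS₀ U)
  rw [hS'eq]
  exact hrows f hf f' (hf'eq ▸ hD.1 X) hf'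

/-- ★★ **Every conjugation-invariant finite measure is a conjugation-invariant row state** — for a
representation with the Schur second moments, a family of exponential shifts with TRACELESS
generators and conjugation-invariant polynomial local actions, at EVERY real `β` (both sides of
every row vanish, `sdRow_of_conjInvariant`). [folklore] -/
theorem isConjInvariantRowState_of_conjInvariant [IsTopologicalGroup G] [CompactSpace G]
    [BorelSpace G] [SecondCountableTopology G] [Countable ι]
    (hr : HasSchurMoments r) {k : K → ℝ → G} {X : K → Matrix (Fin r.N) (Fin r.N) ℂ}
    (hX : ∀ a t, r.ρ (k a t) = exp ((t : ℂ) • X a)) (htr : ∀ a, (X a).trace = 0)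
    {S : ι → (ι → G) → ℝ} (hS : ∀ i, S i ∈ polyFunctions (ι := ι) r)
    (hSi : ∀ i g U, S i (conjAct g U) = S i U) (β : ℝ) {μ : Measure (ι → G)} [IsFiniteMeasure μ]
    (hμ : ∀ g : G, μ.map (conjAct g) = μ) : IsConjInvariantRowState r k S β μ := by
  intro i a f hf hfi f' S' hf' hS'
  obtain ⟨Df, hDf⟩ := exists_hasLinearShiftDeriv_of_mem_polyFunctions r i hf
  obtain ⟨DS, hDS⟩ := exists_hasLinearShiftDeriv_of_mem_polyFunctions r i (hS i)
  exact sdRow_of_conjInvariant hr hμ hDf hDS (continuous_of_mem_polyFunctions r hf) hfi (hSi i)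
    (hX a) (htr a) hf' hS' β

end Generic

/-! ## `SU(N)` on the torus: two solutions with different plaquettes -/

section Torus

variable {d L : ℕ} [NeZero L]

/-- ★★ **`SU(N)` on `(ℤ/L)^d`: every finite measure invariant under global conjugation solves the
conjugation-invariant sub-system of the Wilson Schwinger–Dyson rows (shifts `e^{tX}`,
`X ∈ 𝔰𝔲(N)`) at EVERY `β`.** [folklore] -/
theorem isConjInvariantRowState_suN_of_conjInvariant (N : ℕ) (β : ℝ)
    {μ : Measure (GaugeConfig d L (Matrix.specialUnitaryGroup (Fin N) ℂ))} [IsFiniteMeasure μ]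
    (hμ : ∀ g, μ.map (conjAct g) = μ) :
    IsConjInvariantRowState (fundamentalLatticeRep N) (suExp N)
      (fun _ => wilsonAction (d := d) (L := L) (fundamentalRep (Fin N))) β μ :=
  isConjInvariantRowState_of_conjInvariant (hasSchurMoments_suN N)
    (X := fun X : SuGenerator N => (X : Matrix (Fin N) (Fin N) ℂ)) (rho_suExp N) (fun X => X.2.2)
    (fun _ => wilsonAction_mem_polyFunctions (fundamentalLatticeRep N))
    (fun _ g U => wilsonAction_conjAct (fundamentalRep (Fin N)) g U) β hμ

/-- **Wilson's measure at ANY coupling `β'` solves the sub-system at `β`.** [folklore] -/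
theorem isConjInvariantRowState_wilsonMeasure_suN (N : ℕ) (β β' : ℝ) :
    IsConjInvariantRowState (fundamentalLatticeRep N) (suExp N)
      (fun _ => wilsonAction (d := d) (L := L) (fundamentalRep (Fin N))) β
      (wilsonMeasure (d := d) (L := L) (fundamentalRep (Fin N)) β') := by
  haveI := isProbabilityMeasure_wilsonMeasure (d := d) (L := L) (fundamentalRep (Fin N))
    (continuous_fundamentalRep (Fin N)) β'
  exact isConjInvariantRowState_suN_of_conjInvariant N β
    fun g => map_conjAct_wilsonMeasure (fundamentalRep (Fin N)) β' g

/-- **Product Haar measure solves the sub-system at every `β`.** [folklore] -/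
theorem isConjInvariantRowState_haar_suN (N : ℕ) (β : ℝ) :
    IsConjInvariantRowState (fundamentalLatticeRep N) (suExp N)
      (fun _ => wilsonAction (d := d) (L := L) (fundamentalRep (Fin N))) β
      (Measure.pi fun _ : Edge d L => haarProbability (Matrix.specialUnitaryGroup (Fin N) ℂ)) := by
  refine isConjInvariantRowState_suN_of_conjInvariant N β fun g => ?_
  rw [← gaugeTransform_const]
  exact (WilsonGauge.measurePreserving_gaugeTransform (fun _ => g)).map_eq

/-- The plaquette mean of product Haar measure vanishes (`N ≥ 2`, `L ≥ 2`; tree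
`integral_re_trace_plaquetteHolonomy_eq_zero`, centre of `SU(N)`). [folklore] -/
theorem integral_plaquette_haar_suN [Fact (1 < L)] {N : ℕ} (hN : 2 ≤ N) (x : Site d L)
    {i j : Fin d} (hij : i ≠ j) :
    ∫ U, (fundamentalRep (Fin N) (plaquetteHolonomy U x i j)).trace.re
      ∂(Measure.pi fun _ : Edge d L => haarProbability (Matrix.specialUnitaryGroup (Fin N) ℂ)) = 0 := by
  obtain ⟨z, ω, hne, hz, -⟩ := IsSpecialUnitaryModel.exists_central (fundamentalRep (Fin N))
    (TorusAreaLaw.isSpecialUnitaryModel_fundamentalRep N) hN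
  exact integral_re_trace_plaquetteHolonomy_eq_zero (fundamentalRep (Fin N))
    (continuous_fundamentalRep (Fin N)) hz hne x hij

/-- The plaquette mean of Wilson's measure is positive at `β > 0` (`N ≥ 2`, `L ≥ 2`; tree
`wilsonExpectation_re_trace_plaquette_pos`). [folklore] -/
theorem integral_plaquette_wilsonMeasure_pos_suN [Fact (1 < L)] {N : ℕ} (hN : 2 ≤ N) {β : ℝ}
    (hβ : 0 < β) (x : Site d L) {i j : Fin d} (hij : i ≠ j) :
    0 < ∫ U, (fundamentalRep (Fin N) (plaquetteHolonomy U x i j)).trace.re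
      ∂(wilsonMeasure (d := d) (L := L) (fundamentalRep (Fin N)) β) := by
  haveI : NeZero N := ⟨by omega⟩
  obtain ⟨z, ω, hne, hz, -⟩ := IsSpecialUnitaryModel.exists_central (fundamentalRep (Fin N))
    (TorusAreaLaw.isSpecialUnitaryModel_fundamentalRep N) hN
  have hω1 : ‖ω‖ = 1 :=
    norm_eq_one_of_map_eq_smul_one (fundamentalRep (Fin N)) (continuous_fundamentalRep (Fin N)) hz
  exact wilsonExpectation_re_trace_plaquette_pos (fundamentalRep (Fin N))
    (continuous_fundamentalRep (Fin N)) hz hω1 hne hβ x hij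

/-- ★★★ **Product Haar measure does NOT solve the full polynomial Schwinger–Dyson system at
`β > 0`** (`SU(N)`, `N ≥ 2`, `L ≥ 2`, two distinct axes): the full system forces Wilson's measure
(`eq_wilsonMeasure_iff_polySD_suN`), whose plaquette mean is positive, while Haar's is zero.
[folklore] -/
theorem haar_not_isPolySchwingerDysonState_suN [Fact (1 < L)] {N : ℕ} (hN : 2 ≤ N) {β : ℝ}
    (hβ : 0 < β) {i j : Fin d} (hij : i ≠ j) :
    ¬ IsPolySchwingerDysonState (fundamentalLatticeRep N) (suExp N)
        (fun _ => wilsonAction (d := d) (L := L) (fundamentalRep (Fin N))) β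
        (Measure.pi fun _ : Edge d L => haarProbability (Matrix.specialUnitaryGroup (Fin N) ℂ)) := by
  intro h
  have heq := (eq_wilsonMeasure_iff_polySD_suN (d := d) (L := L) N β
    (Measure.pi fun _ : Edge d L => haarProbability (Matrix.specialUnitaryGroup (Fin N) ℂ))).2 h
  have h0 := integral_plaquette_haar_suN (d := d) (L := L) hN 0 hij
  have hpos := integral_plaquette_wilsonMeasure_pos_suN (d := d) (L := L) hN hβ 0 hij
  rw [← heq] at hpos
  exact absurd h0 (ne_of_gt hpos)

/-- ★★★ **THE NO-INFORMATION THEOREM** (`SU(N)`, `N ≥ 2`, torus `(ℤ/L)^d` with `L ≥ 2`, axes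
`i ≠ j`, any `β > 0`): the conjugation-invariant sub-system of the Wilson Schwinger–Dyson rows at
coupling `β` has TWO probability solutions — product Haar measure and Wilson's measure — with
DIFFERENT plaquette expectations (`0` versus `> 0`). Conjugation-invariant (a fortiori
gauge-invariant) test functions alone cannot bound the plaquette. [folklore] -/
theorem conjInvariantRows_two_solutions_suN [Fact (1 < L)] {N : ℕ} (hN : 2 ≤ N) {β : ℝ}
    (hβ : 0 < β) (x : Site d L) {i j : Fin d} (hij : i ≠ j) :
    IsConjInvariantRowState (fundamentalLatticeRep N) (suExp N)
        (fun _ => wilsonAction (d := d) (L := L) (fundamentalRep (Fin N))) β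
        (Measure.pi fun _ : Edge d L => haarProbability (Matrix.specialUnitaryGroup (Fin N) ℂ)) ∧
      IsConjInvariantRowState (fundamentalLatticeRep N) (suExp N)
        (fun _ => wilsonAction (d := d) (L := L) (fundamentalRep (Fin N))) β
        (wilsonMeasure (d := d) (L := L) (fundamentalRep (Fin N)) β) ∧
      ∫ U, (fundamentalRep (Fin N) (plaquetteHolonomy U x i j)).trace.re
          ∂(Measure.pi fun _ : Edge d L => haarProbability (Matrix.specialUnitaryGroup (Fin N) ℂ)) = 0 ∧
      0 < ∫ U, (fundamentalRep (Fin N) (plaquetteHolonomy U x i j)).trace.re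
          ∂(wilsonMeasure (d := d) (L := L) (fundamentalRep (Fin N)) β) :=
  ⟨isConjInvariantRowState_haar_suN N β, isConjInvariantRowState_wilsonMeasure_suN N β β,
    integral_plaquette_haar_suN hN x hij, integral_plaquette_wilsonMeasure_pos_suN hN hβ x hij⟩

end Torus

end Summit.QuantumFields.GaugeBoot

end
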